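import Summits.QuantumFields.YangMills.Theorems.BalabanUVNodesN22GenStepRecursion
import Summits.QuantumFields.YangMills.Theorems.BalabanUVNodesN22AtRecordOfOutputLevel

/-!
# BalabanUVNodes ∕ node N22 = NE9 — ROAD 1 AT THE RECORD THROUGH THE TERMS: K3's `h9`, the kernel-face socket and the pin face from the FIRST-ORDER term-level step schema (T1)
# ALONE (pub-balaban's `StepLipschitz` read on node00-def-W1's complex (2.13) terms via module J51's re-twist) + term holomorphy through the readings ∕ tails ∕ W1-20's law ∕ (1.21),
# under the END OF RECORD's SMALL-GROWTH clause `ω₁ + c ≤ ℓ.ω` — NO node-N18 letter, NO second order, NO output bound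

Cell `pub-ymgap`, HUMAN RULING D-0062 (Track A), R134 seat `pub-ymgap-dag-n22-c` (strategy s1), generation 17, module J55.  THEOREMS ONLY (no `def`, no `sorry`, standard axioms);
`--kind proof --supports stmt-QuantumFields-27366 --as helper` (K3⁸ `SpineGivenEndpointR13SepCoPHV`, skeleton v6 — §2b N22 face `h9` verbatim), COUNT-NEUTRAL.  Imports module J53
`…N22GenStepRecursion` (through it J51's `termNE9_of_termStepLipschitz` — ROAD 1 at the term level — and `termT1_toClusterTower_of_gen`, def-W1's `HistoryRecursionOfRecord`) and
dag-n22-w5's `…N22AtRecordOfOutputLevel` (`AtRecordOfPrintedSlots.ne9_EA_objectsOfRecord₁₃_of_outputCoordLetters` = this lane's g13 `OutputLevel.windowedNE9_localizedSum_of_outputCoordLetters`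
∘ W1-19b ∘ (1.21), at the record).  Nothing re-declared; every step is plain application.

WHY.  Modules J50∕J52∕J54 key K3's `h9` to ROAD 2 (node N18's kernel step rate + SECOND-order step schemas, any growth `ν` of the recursion against the row `ℓ.θ₅·ν ≤ ℓ.ω²`).  The tree's
ROAD 1 — the END OF RECORD's road (`Spine/NE9/LeafIndex.rootShape_of_leaves`, structural core pub-balaban's `ne9_of_stepLipschitz`): FIRST-order step Lipschitz structure ⟹ NE9 with
moduli `ℓ₁(ω₁ + c)^{age}`, FADING iff `ω₁ + c < 1` (clause N2; dag-n22-a's `sticky_not_fadingMemory`: no fading without it on that road) — had NO edition at the kernel objects of record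
(`rg ne9_of_stepLipschitz Summits/` = dag-n22-a's `N22KnitRecursion`, J50, J51 only).  J51's re-twist runs it on the complex (2.13) terms; THIS FILE reads it at the record: IF the
recursion's first-order growth sits below the record's fading ratio, `ω₁ + c ≤ ℓ.ω`, THEN (T1) alone — with term holomorphy through the readings, tails, W1-20's law and (1.21) — gives
K3's `h9` WITH THE RECORD's GEOMETRIC MODULI; node N18's letter, the second-order schemas and the output bound are NOT needed.  The honest alternative to §3c's «one inequality»
`θ₅·ν ≤ ω²` of ROAD 2 is thus ROAD 1's `ω₁ + c ≤ ω`; which road a producer can serve depends on whether N10's one-step map contracts (`ω₁ + c < 1`, [I]'s small-field regime letters) or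
only N18's UV rate beats its growth.
* §1 (ns `YMDAG.N22.TermRecursion`) ★ `coordLetter_box_of_termStepLipschitz` — (T1) + `lam ≤ ℓ₁` + `a k j ≤ c·ω₁^{k−j}` ⟹ the per-coordinate OUTPUT-LEVEL coupling letters of this lane's
  g13 ∕ dag-n22-w5's J34-at-record, `‖E^{(k+1)}(X; g; φ) − E^{(k+1)}(X; g∣g_i:=t; φ)‖ ≤ ℓ₁(ω₁+c)^{k−i}·e^{−κd_{k+1}(X)}·|g_i − t|` on the boxes (J51's `termNE9_of_termStepLipschitz` at
  `g′ := g∣g_i:=t`); ★ `coordLetter_box_truncRun` (run truncation, `E_termlessTower`); ★ `coordLetter_box_truncRun_toClusterTower_of_gen` — the same letters for def-W1's run towers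
  `truncRun K (toClusterTower G)` from the GENERATOR schema (G-T1) + (Adm-run) (J53 §1); ★ `table_le_moduli_of_rows` — the geometric table `C·ℓ₁μ^{k−1−i}` is dominated by the
  record's `ℓ.moduli k i = C₉ω^{k−i}` as soon as `0 ≤ μ ≤ ℓ.ω` and `C·ℓ₁ ≤ ℓ.C₉·ℓ.ω` (J37's audit bites UNIFORM tables only; a DECAYING geometric table passes).
* §2 (ns `YMDAG.N22.KernelFading`) ★★★ `ne9_EA_objectsOfRecord₁₃_of_termStepLipschitz` — AT THE RECORD: ON EVERY TORUS TOWER `S K` the schema (T1) (`lam K k ≤ ℓ₁`, `a K k j ≤ c·ω₁^{k−j}`,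
  rate `κ_E ≥ κ`); term holomorphy through the complexified readings of record, chart ∕ space clauses, site-weight tails, `2κ₀(64,8) ≤ κ`; W1-20's law; (1.21); the ROWS
  **`ω₁ + c ≤ ℓ.ω`**, `ℓ.κ ≤ δ₁`, `C·ℓ₁ ≤ ℓ.C₉·ℓ.ω` with `C = (16B₃²∕r²)e^{12Mδ₁}K₀K₁` ⟹ **`NE9 ((objectsOfRecord₁₃ F N θ ℓ).EA 0) (Window θ.γ) ℓ.κ ℓ.moduli`** — §1 per torus into
  dag-n22-w5's `ne9_EA_objectsOfRecord₁₃_of_outputCoordLetters` with `Λt n i := ℓ₁(ω₁+c)^{n−1−i}`.  ★★★ `n22At_u3OfRecord₁₃_of_termStepLipschitz` (kernel-face socket, dag-n27-c's `h22`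
  row), ★★★ `n22At_rateCarriers_of_kernels_pin_of_termStepLipschitz` (pin face).
THE N22 ROW SENTENCE on ROAD 1: «the first-order Lipschitz structure of the step map {last coupling, older TERMS} ↦ new TERM on every torus with growth `ω₁ + c ≤ ω` (the END's
clause N2 in the record's letters) + the readings, the law and (1.21) ⟹ K3's `h9` — nothing from node N18».  The rows are jointly satisfiable with `ℓ.Signs` iff `ω₁ + c < 1`.

HONEST FRAMING (binding).  Count-neutral COMPOSITION; (T1) ∕ (G-T1) ∕ (Adm-run) are UNPRINTED hypothesis SHAPES (GAPS G-t4-U3-1; [I] prints (0.23) p. 256, (2.12)–(2.13) p. 268, p. 263,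
p. 298 without constants — NOTHING quantitative in the older couplings); the clause `ω₁ + c ≤ ℓ.ω` is the END OF RECORD's N2 (NOT PRINTED; whether Bałaban's step map contracts in the
older terms is exactly GAPS G-t4-U3-1's open letter); nothing of the record is constructed or claimed to meet the displayed inputs; `𝔸 : Type`.  N22 is NOT discharged (typed 28∕28 ·
discharged 5∕27 UNCHANGED); K3⁸ OPEN and NOT claimed (no stub of 27366 touched); NE9 is NOT IN PRINT for d = 4; no count claim; one finite 𝕋⁴ programme at fixed ε — R4 closes the
CONDITIONAL rung `BalabanLadder.UV` only; NOTHING about the continuum limit, ℝ⁴, infinite volume, OS axioms, a mass gap or the Clay problem is proved or claimed.  References (TYPES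
only, no cite tags on the Summit side): [I] = Bałaban, CMP 109 (1987) Thm 1 p. 259, (0.23) p. 256, (1.7) p. 261, §1 p. 263, (1.20)–(1.22) p. 264, §2 p. 266, (2.12)–(2.13) p. 268,
p. 282, (4.35)–(4.37) pp. 290–291, (5.10) p. 293, §5 p. 298; [II] = CMP 116 (1988) (2.13)–(2.14) pp. 14–15.
-/

noncomputable section

open Filter Topology Set Metric
open scoped BigOperators

/-! ## §1 Term level: ROAD 1's per-coordinate letters on the boxes, their run truncation and generator edition; the table row -/

namespace YMDAG.N22.TermRecursion

open Literature.MathematicalPhysics.QuantumFieldTheory.Balaban1983to89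
open Literature.MathematicalPhysics.QuantumFieldTheory.Balaban1983to89.T4OutputRate (Window)
open Literature.MathematicalPhysics.QuantumFieldTheory.Balaban1983to89.Node00 (U3Letters₁₁)
open Literature.MathematicalPhysics.QuantumFieldTheory.Balaban1983to89.Node00.Sect2 (domSys CPair)
open Literature.MathematicalPhysics.QuantumFieldTheory.Balaban1983to89.Node00.W1
open YMDAG.N22.KernelFading (update_mem_window)
open YMDAG.N22.WindowedSecondDiff (histPrefix_update)

variable {P : Params} {𝔸 : Type} {M : ℕ} (S : ClusterTower P 𝔸 M) (sp : (k : ℕ) → (domSys P M (k + 1)).Dom → Set (CPair P 𝔸))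

open Finset in
/-- ★ **ROAD 1's PER-COORDINATE OUTPUT-LEVEL LETTERS FROM (T1).**  On one tower with a space table non-empty at every point and `0 < γ`: (T1) + `lam ≤ ℓ₁` (`ℓ₁ ≥ 0`) +
`a k j ≤ c·ω₁^{k−j}` (`c, ω₁ ≥ 0`) ⟹ for every box prefix `g ∈ ]0, γ]^{k+1}`, coordinate `i ≤ k`, `t ∈ ]0, γ]`, domain `X` and admissible `φ`:
**`‖(S k).E g φ X − (S k).E (g∣g_i:=t) φ X‖ ≤ ℓ₁(ω₁ + c)^{k−i}·e^{−κ d_{k+1}(X)}·|g_i − t|`** — J51's `termNE9_of_termStepLipschitz` (ROAD 1 on the re-twisted functional) at the window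
extension of `g` and its update, the sum collapsing to the `i`-th term.  This is the `hlet` shape of g13's `windowedNE9_localizedSum_of_outputCoordLetters` ∕ dag-n22-w5's J34-at-record
with `Λt n i = ℓ₁(ω₁ + c)^{n−1−i}`. [folklore] -/
theorem coordLetter_box_of_termStepLipschitz (hsp : ∀ k X, (sp k X).Nonempty) {γ κ ℓ₁ c ω₁ : ℝ} {lam : ℕ → ℝ} {a : ℕ → ℕ → ℝ} (hγ : 0 < γ)
    (hT1 : ∀ g ∈ Window γ, ∀ g' ∈ Window γ, ∀ (D : ℕ → ℝ) (k : ℕ),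
      (∀ k' < k, ∀ (X' : (domSys P M (k' + 1)).Dom), ∀ φ' ∈ sp k' X',
        ‖termC S (k' + 1) X' g φ' - termC S (k' + 1) X' g' φ'‖ ≤ Real.exp (-(κ * (domSys P M (k' + 1)).dj X')) * D (k' + 1)) →
      ∀ (X : (domSys P M (k + 1)).Dom), ∀ φ ∈ sp k X,
        ‖termC S (k + 1) X g φ - termC S (k + 1) X g' φ‖ ≤ Real.exp (-(κ * (domSys P M (k + 1)).dj X)) * (lam k * |g k - g' k| + ∑ j ∈ range (k + 1), a k j * D j))
    (hlam : ∀ k, lam k ≤ ℓ₁) (hℓ₁ : 0 ≤ ℓ₁) (ha : ∀ k j, j ≤ k → a k j ≤ c * ω₁ ^ (k - j)) (hc : 0 ≤ c) (hω₁ : 0 ≤ ω₁) :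
    ∀ (k : ℕ), ∀ g ∈ box γ k, ∀ (i : Fin (k + 1)), ∀ t ∈ Ioc (0 : ℝ) γ, ∀ (X : (domSys P M (k + 1)).Dom), ∀ φ ∈ sp k X,
      ‖(S k).E g φ X - (S k).E (Function.update g i t) φ X‖ ≤ ℓ₁ * (ω₁ + c) ^ (k - (i : ℕ)) * Real.exp (-(κ * (domSys P M (k + 1)).dj X)) * |g i - t| := by
  have hNE := termNE9_of_termStepLipschitz S sp hsp hT1 hlam hℓ₁ ha hc hω₁
  intro k gb hgb i t ht X φ hφ
  -- extend the box history to a window history by `γ`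
  obtain ⟨g, hg⟩ : ∃ g : ℕ → ℝ, g = fun n => if h : n < k + 1 then gb ⟨n, h⟩ else γ := ⟨_, rfl⟩
  have hgn : ∀ n (hn : n < k + 1), g n = gb ⟨n, hn⟩ := fun n hn => by rw [hg]; exact dif_pos hn
  have hres : Node00.U3OfKernels.histPrefix g k = gb := funext fun j => hgn j j.2
  have hgW : g ∈ Window γ := by
    intro n
    by_cases hn : n < k + 1
    · rw [hgn n hn]; exact hgb ⟨n, hn⟩
    · have e : g n = γ := by rw [hg]; exact dif_neg hn
      rw [e]; exact ⟨hγ, le_rfl⟩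
  have key := hNE g hgW _ (update_mem_window hgW i ht) k X φ hφ
  have h1 : termC S (k + 1) X g φ = (S k).E gb φ X := by
    rw [termC_succ, show restrictPrefix k g = Node00.U3OfKernels.histPrefix g k from rfl, hres]
  have h2 : termC S (k + 1) X (Function.update g i t) φ = (S k).E (Function.update gb i t) φ X := by
    rw [termC_succ, show restrictPrefix k (Function.update g (i : ℕ) t) = Node00.U3OfKernels.histPrefix (Function.update g (i : ℕ) t) k from rfl,
      histPrefix_update g k i.2, hres]
  have hsum : ∑ j ∈ range (k + 1), ℓ₁ * (ω₁ + c) ^ (k - j) * |g j - Function.update g (i : ℕ) t j| = ℓ₁ * (ω₁ + c) ^ (k - (i : ℕ)) * |gb i - t| := by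
    rw [sum_eq_single_of_mem (i : ℕ) (mem_range.mpr i.2) fun j _ hji => by rw [Function.update_of_ne hji, sub_self, abs_zero, mul_zero],
      Function.update_self, hgn i i.2]
  rw [h1, h2, hsum] at key
  refine key.trans (le_of_eq ?_)
  ring

/-- ★ **PER-COORDINATE LETTERS WITH A NON-NEGATIVE TABLE PASS TO THE RUN TRUNCATIONS** (`truncRun_of_lt` below the run length; `E_termlessTower` at and beyond it). [folklore] -/
theorem coordLetter_box_truncRun (K : ℕ) {γ κ : ℝ} {T : ℕ → ℕ → ℝ} (hT : ∀ k i, 0 ≤ T k i)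
    (h : ∀ (k : ℕ), ∀ g ∈ box γ k, ∀ (i : Fin (k + 1)), ∀ t ∈ Ioc (0 : ℝ) γ, ∀ (X : (domSys P M (k + 1)).Dom), ∀ φ ∈ sp k X,
      ‖(S k).E g φ X - (S k).E (Function.update g i t) φ X‖ ≤ T k i * Real.exp (-(κ * (domSys P M (k + 1)).dj X)) * |g i - t|) :
    ∀ (k : ℕ), ∀ g ∈ box γ k, ∀ (i : Fin (k + 1)), ∀ t ∈ Ioc (0 : ℝ) γ, ∀ (X : (domSys P M (k + 1)).Dom), ∀ φ ∈ sp k X,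
      ‖(truncRun K S k).E g φ X - (truncRun K S k).E (Function.update g i t) φ X‖ ≤ T k i * Real.exp (-(κ * (domSys P M (k + 1)).dj X)) * |g i - t| := by
  intro k g hg i t ht X φ hφ
  by_cases hk : k < K
  · rw [truncRun_of_lt S hk]
    exact h k g hg i t ht X φ hφ
  · rw [truncRun_of_le S (Nat.not_lt.mp hk), E_termlessTower, E_termlessTower, sub_zero, norm_zero]
    have := hT k i
    positivity

open Finset in
/-- ★ **ROAD 1's PER-COORDINATE LETTERS FOR node00-def-W1's RUN TOWERS FROM THE GENERATOR SCHEMA (G-T1).**  For a generator tower `G` with (Adm-run) along the window and the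
one-step map's first-order schema (G-T1) (J53) with `lam ≤ ℓ₁`, `a k j ≤ c·ω₁^{k−j}`: the letters of `coordLetter_box_of_termStepLipschitz` hold for every run tower
`truncRun K (toClusterTower G)` — J53's `termT1_toClusterTower_of_gen`, then the two lemmas above. [folklore] -/
theorem coordLetter_box_truncRun_toClusterTower_of_gen (G : GenTower P 𝔸 M) (Adm : (k : ℕ) → OlderTerms P 𝔸 M k → Prop) (hsp : ∀ k X, (sp k X).Nonempty)
    {γ κ ℓ₁ c ω₁ : ℝ} {lam : ℕ → ℝ} {a : ℕ → ℕ → ℝ} (hγ : 0 < γ) (hAdm : ∀ g ∈ Window γ, ∀ k, Adm k (olderOf (recTerm G fun n => ((g n : ℝ) : ℂ)) k))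
    (hG1 : ∀ (k : ℕ), ∀ t ∈ Ioc (0 : ℝ) γ, ∀ t' ∈ Ioc (0 : ℝ) γ, ∀ (old old' : OlderTerms P 𝔸 M k), Adm k old → Adm k old' → ∀ (D : ℕ → ℝ),
      (∀ (k' : ℕ) (hk' : k' < k) (Y : (domSys P M (k' + 1)).Dom), ∀ φ' ∈ sp k' Y,
        ‖old ⟨k' + 1, Nat.succ_lt_succ hk'⟩ Y φ' - old' ⟨k' + 1, Nat.succ_lt_succ hk'⟩ Y φ'‖ ≤ Real.exp (-(κ * (domSys P M (k' + 1)).dj Y)) * D (k' + 1)) →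
      ∀ (X : (domSys P M (k + 1)).Dom), ∀ φ ∈ sp k X,
        ‖(G k).E ((t : ℝ) : ℂ) old φ X - (G k).E ((t' : ℝ) : ℂ) old' φ X‖ ≤
          Real.exp (-(κ * (domSys P M (k + 1)).dj X)) * (lam k * |t - t'| + ∑ j ∈ range (k + 1), a k j * D j))
    (hlam : ∀ k, lam k ≤ ℓ₁) (hℓ₁ : 0 ≤ ℓ₁) (ha : ∀ k j, j ≤ k → a k j ≤ c * ω₁ ^ (k - j)) (hc : 0 ≤ c) (hω₁ : 0 ≤ ω₁) (K : ℕ) :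
    ∀ (k : ℕ), ∀ g ∈ box γ k, ∀ (i : Fin (k + 1)), ∀ t ∈ Ioc (0 : ℝ) γ, ∀ (X : (domSys P M (k + 1)).Dom), ∀ φ ∈ sp k X,
      ‖(truncRun K (toClusterTower G) k).E g φ X - (truncRun K (toClusterTower G) k).E (Function.update g i t) φ X‖ ≤
        ℓ₁ * (ω₁ + c) ^ (k - (i : ℕ)) * Real.exp (-(κ * (domSys P M (k + 1)).dj X)) * |g i - t| :=
  coordLetter_box_truncRun (toClusterTower G) sp K (T := fun k i => ℓ₁ * (ω₁ + c) ^ (k - i)) (fun k i => by positivity)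
    (coordLetter_box_of_termStepLipschitz (toClusterTower G) sp hsp hγ (termT1_toClusterTower_of_gen G sp Adm hAdm hG1) hlam hℓ₁ ha hc hω₁)

/-- ★ **THE TABLE ROW**: a DECAYING geometric table `C·ℓ₁·μ^{k−1−i}` is dominated by the record's moduli `ℓ.moduli k i = C₉·ω^{k−i}` whenever `0 ≤ μ ≤ ℓ.ω` and `C·ℓ₁ ≤ ℓ.C₉·ℓ.ω`
(`ℓ.Signs`: `0 ≤ ω < 1`, `0 ≤ C₉`; no sign needed on `C`, `ℓ₁`) — J37's audit (`le_zero_of_forall_le_moduli`) concerns age-UNIFORM tables only. [folklore] -/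
theorem table_le_moduli_of_rows (ℓ : U3Letters₁₁) (hs : ℓ.Signs) {C ℓ₁ μ : ℝ} (hμ0 : 0 ≤ μ) (hμ : μ ≤ ℓ.ω)
    (hrow : C * ℓ₁ ≤ ℓ.C₉ * ℓ.ω) : ∀ k i : ℕ, C * (ℓ₁ * μ ^ (k - 1 - i)) ≤ ℓ.moduli k i := by
  intro k i
  rw [U3Letters₁₁.moduli_apply, ← mul_assoc]
  rcases Nat.lt_or_ge i k with h | h
  · rw [show k - i = (k - 1 - i) + 1 by omega, pow_succ]
    calc C * ℓ₁ * μ ^ (k - 1 - i) ≤ ℓ.C₉ * ℓ.ω * ℓ.ω ^ (k - 1 - i) :=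
          mul_le_mul hrow (pow_le_pow_left₀ hμ0 hμ _) (pow_nonneg hμ0 _) (mul_nonneg hs.C₉_nonneg hs.ω_nonneg)
      _ = ℓ.C₉ * (ℓ.ω ^ (k - 1 - i) * ℓ.ω) := by ring
  · rw [show k - 1 - i = 0 by omega, show k - i = 0 by omega, pow_zero, pow_zero, mul_one, mul_one]
    exact hrow.trans (mul_le_of_le_one_right hs.C₉_nonneg hs.ω_lt_one.le)

end YMDAG.N22.TermRecursion

/-! ## §2 At the record: K3's `h9`, the kernel-face socket and the pin face on ROAD 1 — (T1) + readings ∕ tails ∕ law ∕ (1.21) + `ω₁ + c ≤ ℓ.ω` -/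

namespace YMDAG.N22.KernelFading

open Literature.MathematicalPhysics.QuantumFieldTheory.Balaban1983to89
open Literature.MathematicalPhysics.QuantumFieldTheory.Balaban1983to89.T4Continuum (T4Family ULoop)
open Literature.MathematicalPhysics.QuantumFieldTheory.Balaban1983to89.T4OutputRate (Window NE9)
open Literature.MathematicalPhysics.QuantumFieldTheory.Balaban1983to89.TreeLengthTorus (TPt)
open Literature.MathematicalPhysics.QuantumFieldTheory.Balaban1983to89.B12TreeDecay (K₀ kappa₀ K₀_pos)
open Literature.MathematicalPhysics.QuantumFieldTheory.Balaban1983to89.B12Decay510 (delta1)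
open Literature.MathematicalPhysics.QuantumFieldTheory.Balaban1983to89.B12Decay510Window (K₁ K₁_nonneg)
open Literature.MathematicalPhysics.QuantumFieldTheory.Balaban1983to89.B12Decay510Torus (distCT nearT)
open Literature.MathematicalPhysics.QuantumFieldTheory.Balaban1983to89.Node00 (Stage13Params Stage13HParams U3Letters₁₁ MatA)
open Literature.MathematicalPhysics.QuantumFieldTheory.Balaban1983to89.Node00.Sect2 (domSys domCount CPair)
open Literature.MathematicalPhysics.QuantumFieldTheory.Balaban1983to89.Node00.W1
open Literature.MathematicalPhysics.QuantumFieldTheory.Balaban1983to89.Node00.LocalizedSum17 (ReadingMaps Localizes17OfRecord₁₃)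
open Literature.MathematicalPhysics.QuantumFieldTheory.Balaban1983to89.Node00.U3OfKernels (histPrefix objectsOfRecord₁₃)
open Literature.MathematicalPhysics.QuantumFieldTheory.Balaban1983to89.Node00.U3KernelLetters (PolLimitsExistOfRecord₁₃)
open YMDAG.UVSplit (N22At u3OfRecord₁₃ RateReading₁₃CoPH rateCarriersOfRecord₁₃CoPH)
open YMDAG.N22.AtKernels (n22At_rateCarriers_of_kernels_pin_of_ne9 n22At_u3OfRecord₁₃_objectsOfRecord₁₃_iff)
open YMDAG.N22.AtRecordOfPrintedSlots (ne9_EA_objectsOfRecord₁₃_of_outputCoordLetters)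
open YMDAG.N22.TermRecursion (coordLetter_box_of_termStepLipschitz table_le_moduli_of_rows)

open scoped Matrix.Norms.L2Operator

variable (F : T4Family) (N : ℕ) [NeZero N] {𝔸 : Type} {M : ℕ}

open Classical Finset in
/-- ★★★ **K3's `h9` ON ROAD 1: FROM THE FIRST-ORDER TERM-LEVEL STEP SCHEMA (T1) ON EVERY TORUS TOWER + READINGS ∕ TAILS ∕ LAW ∕ (1.21), UNDER `ω₁ + c ≤ ℓ.ω` — NO NODE-N18 LETTER,
NO SECOND ORDER, NO OUTPUT BOUND.**  At a Stage-13 tuple `θ` (`0 < θ.γ`) with a letter block `ℓ` (`ℓ.Signs`): towers `S K` read through `emb` with W1-20's law and (1.21); ON EVERY `S K`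
the schema (T1) (pub-balaban's `StepLipschitz` on the (2.13) terms: `lam K k ≤ ℓ₁`, `a K k j ≤ c·ω₁^{k−j}`, rate `κ_E ≥ κ`); term holomorphy through the complexified readings of record,
chart ∕ space clauses, site-weight tails (`w ≤ B₃e^{−δ₀·dist}`), `2κ₀(64,8) ≤ κ`; the ROWS **`ω₁ + c ≤ ℓ.ω`**, `ℓ.κ ≤ δ₁`, `C·ℓ₁ ≤ ℓ.C₉·ℓ.ω` with `C = (16B₃²∕r²)e^{12Mδ₁}K₀K₁` ⟹
**`NE9 ((objectsOfRecord₁₃ F N θ ℓ).EA 0) (Window θ.γ) ℓ.κ ℓ.moduli`** — §1 per torus (tables non-empty by `hΦsp` at `z = 0`; rate lowered `κ_E → κ`) into dag-n22-w5's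
`ne9_EA_objectsOfRecord₁₃_of_outputCoordLetters` with `Λt n i := ℓ₁(ω₁ + c)^{n−1−i}` and `table_le_moduli_of_rows`.  The rows are jointly satisfiable with `ℓ.Signs` iff `ω₁ + c < 1`
(the END OF RECORD's clause N2).  LOCATED (hypothesis form); N22 NOT discharged. [folklore] -/
theorem ne9_EA_objectsOfRecord₁₃_of_termStepLipschitz (θ : Stage13Params F N) (ℓ : U3Letters₁₁) (hs : ℓ.Signs) (hγ : 0 < θ.γ) (hlim : PolLimitsExistOfRecord₁₃ F N θ)
    (m' : ℕ) (M : ℕ) [NeZero M] (hM : M = F.L ^ m')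
    (S : (K : ℕ) → ClusterTower (F.P K) 𝔸 M) (emb : ReadingMaps F (MatA N) 𝔸) (hloc : Localizes17OfRecord₁₃ F N θ S emb)
    (sp : (K k : ℕ) → (domSys (F.P K) M (k + 1)).Dom → Set (CPair (F.P K) 𝔸))
    {κ κE δ₀ B₃ r ℓ₁ c ω₁ : ℝ} {lam : ℕ → ℕ → ℝ} {a : ℕ → ℕ → ℕ → ℝ}
    (hκ₀ : kappa₀ (4 * 2 ^ 4) (2 * 4) ≤ κ / 2) (hδ₀ : 0 < δ₀) (hB₃ : 0 ≤ B₃) (hr : 0 < r) (hκE : κ ≤ κE)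
    (hT1 : ∀ K, ∀ g ∈ Window θ.γ, ∀ g' ∈ Window θ.γ, ∀ (D : ℕ → ℝ) (k : ℕ),
      (∀ k' < k, ∀ (X' : (domSys (F.P K) M (k' + 1)).Dom), ∀ φ' ∈ sp K k' X',
        ‖termC (S K) (k' + 1) X' g φ' - termC (S K) (k' + 1) X' g' φ'‖ ≤ Real.exp (-(κE * (domSys (F.P K) M (k' + 1)).dj X')) * D (k' + 1)) →
      ∀ (X : (domSys (F.P K) M (k + 1)).Dom), ∀ φ ∈ sp K k X,
        ‖termC (S K) (k + 1) X g φ - termC (S K) (k + 1) X g' φ‖ ≤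
          Real.exp (-(κE * (domSys (F.P K) M (k + 1)).dj X)) * (lam K k * |g k - g' k| + ∑ j ∈ range (k + 1), a K k j * D j))
    (hlam : ∀ K k, lam K k ≤ ℓ₁) (hℓ₁ : 0 ≤ ℓ₁) (ha : ∀ K k j, j ≤ k → a K k j ≤ c * ω₁ ^ (k - j)) (hc : 0 ≤ c) (hω₁ : 0 ≤ ω₁)
    (Ec : ℕ → ℕ → Type*) [∀ K k, NormedAddCommGroup (Ec K k)] [∀ K k, NormedSpace ℂ (Ec K k)]
    (ι : letI := θ.instVβ₁; letI := θ.instVβ₂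
      (K k : ℕ) → (domSys (F.P K) M (k + 1)).Dom → ((Fin (F.P K).d → Site (F.P K) (k + 1) → θ.Vβ) →L[ℝ] Ec K k))
    (Φ : (K k : ℕ) → (domSys (F.P K) M (k + 1)).Dom → Ec K k → CPair (F.P K) 𝔸)
    (U : (K k : ℕ) → (domSys (F.P K) M (k + 1)).Dom → Set (Ec K k)) (hU : ∀ K k X, IsOpen (U K k X)) (hrU : ∀ K k X, ball (0 : Ec K k) r ⊆ U K k X)
    (hEhol : ∀ g ∈ Window θ.γ, ∀ (K k : ℕ) (X : (domSys (F.P K) M (k + 1)).Dom),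
      DifferentiableOn ℂ (fun z => ((S K) k).E (histPrefix g k) (Φ K k X z) X) (U K k X))
    (hΦemb : letI := θ.instVβ₁; letI := θ.instVβ₂
      ∀ (K k : ℕ) (X : (domSys (F.P K) M (k + 1)).Dom) (Bf : Fin (F.P K).d → Site (F.P K) (k + 1) → θ.Vβ),
        Φ K k X (ι K k X Bf) = emb K k (fun l t => NormedSpace.exp (θ.ρ8 (Bf l t))))
    (hΦsp : ∀ (K k : ℕ) (X : (domSys (F.P K) M (k + 1)).Dom), ∀ z ∈ ball (0 : Ec K k) r, Φ K k X z ∈ sp K k X)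
    (w : (K k : ℕ) → (domSys (F.P K) M (k + 1)).Dom → Site (F.P K) (k + 1) → ℝ) (hw₀ : ∀ K k X t, 0 ≤ w K k X t)
    (hw : letI := θ.instVβ₁; letI := θ.instVβ₂; letI := θ.instιβ
      ∀ (K k : ℕ) (X : (domSys (F.P K) M (k + 1)).Dom) (l : Fin (F.P K).d) (t : Site (F.P K) (k + 1)) (c : θ.ιβ),
        ‖ι K k X (Pi.single l (Pi.single t (θ.bV c)))‖ ≤ w K k X t)
    (htail : ∀ (K k : ℕ) (X : (domSys (F.P K) M (k + 1)).Dom) (t : Site (F.P K) (k + 1)),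
      let e : Site (F.P K) (k + 1) → TPt 4 (domCount (F.P K) M (k + 1) * M) := fun x i => (ZMod.cast (x i) : ZMod (domCount (F.P K) M (k + 1) * M))
      w K k X t ≤ B₃ * Real.exp (-δ₀ * distCT (domCount (F.P K) M (k + 1)) M (e t) (nearT (M := M) (e t) X)))
    (hμω : ω₁ + c ≤ ℓ.ω) (hℓκ : ℓ.κ ≤ delta1 δ₀ κ ((M : ℝ) * 4))
    (hrow : 16 * B₃ ^ 2 / r ^ 2 * Real.exp (delta1 δ₀ κ ((M : ℝ) * 4) * ((M : ℝ) * 4) * 3) * K₀ (4 * 2 ^ 4) (2 * 4) * K₁ 4 (δ₀ / 2) * ℓ₁ ≤ ℓ.C₉ * ℓ.ω) :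
    NE9 ((objectsOfRecord₁₃ F N θ ℓ).EA 0) (Window θ.γ) ℓ.κ ℓ.moduli := by
  have hμ0 : 0 ≤ ω₁ + c := add_nonneg hω₁ hc
  -- §1 per torus: ROAD 1's per-coordinate letters at rate `κE`, lowered to `κ`
  have hsp : ∀ (K k : ℕ) (X : (domSys (F.P K) M (k + 1)).Dom), (sp K k X).Nonempty := fun K k X => ⟨Φ K k X 0, hΦsp K k X 0 (mem_ball_self hr)⟩
  have hlet : ∀ (K k : ℕ), ∀ g ∈ box θ.γ k, ∀ (i : Fin (k + 1)), ∀ t ∈ Ioc (0 : ℝ) θ.γ, ∀ (X : (domSys (F.P K) M (k + 1)).Dom), ∀ φ ∈ sp K k X,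
      ‖((S K) k).E g φ X - ((S K) k).E (Function.update g i t) φ X‖ ≤
        (fun n i : ℕ => ℓ₁ * (ω₁ + c) ^ (n - 1 - i)) (k + 1) i * Real.exp (-(κ * (domSys (F.P K) M (k + 1)).dj X)) * |g i - t| := by
    intro K k g hg i t ht X φ hφ
    have h := coordLetter_box_of_termStepLipschitz (S K) (sp K) (hsp K) hγ (hT1 K) (hlam K) hℓ₁ (ha K) hc hω₁ k g hg i t ht X φ hφ
    have hd : 0 ≤ (domSys (F.P K) M (k + 1)).dj X := (domSys (F.P K) M (k + 1)).dj_nonneg X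
    have hexp : Real.exp (-(κE * (domSys (F.P K) M (k + 1)).dj X)) ≤ Real.exp (-(κ * (domSys (F.P K) M (k + 1)).dj X)) :=
      Real.exp_le_exp.mpr (by nlinarith)
    have hℓμ : 0 ≤ ℓ₁ * (ω₁ + c) ^ (k - (i : ℕ)) := by positivity
    show _ ≤ ℓ₁ * (ω₁ + c) ^ (k + 1 - 1 - (i : ℕ)) * Real.exp (-(κ * (domSys (F.P K) M (k + 1)).dj X)) * |g i - t|
    rw [Nat.add_sub_cancel]
    exact h.trans (mul_le_mul_of_nonneg_right (mul_le_mul_of_nonneg_left hexp hℓμ) (abs_nonneg _))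
  exact ne9_EA_objectsOfRecord₁₃_of_outputCoordLetters F N θ ℓ hs hlim m' M hM S emb hloc sp (fun n i => ℓ₁ * (ω₁ + c) ^ (n - 1 - i)) (fun n i => by positivity)
    hκ₀ hδ₀ hB₃ hr hlet Ec ι Φ U hU hrU hEhol hΦemb hΦsp w hw₀ hw htail hℓκ (table_le_moduli_of_rows ℓ hs hμ0 hμω hrow)

open Classical Finset in
/-- ★★★ **THE KERNEL-FACE SOCKET ON ROAD 1** — the same inputs ⟹ **`N22At (u3OfRecord₁₃ θ (objectsOfRecord₁₃ F N θ ℓ) k)` for EVERY run length `k`** (dag-n27-c's `h22` row), by dag-n22-w3's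
level-free `n22At_u3OfRecord₁₃_objectsOfRecord₁₃_iff`.  LOCATED (hypothesis form); N22 NOT discharged. [folklore] -/
theorem n22At_u3OfRecord₁₃_of_termStepLipschitz (θ : Stage13Params F N) (ℓ : U3Letters₁₁) (hs : ℓ.Signs) (hγ : 0 < θ.γ) (hlim : PolLimitsExistOfRecord₁₃ F N θ)
    (m' : ℕ) (M : ℕ) [NeZero M] (hM : M = F.L ^ m')
    (S : (K : ℕ) → ClusterTower (F.P K) 𝔸 M) (emb : ReadingMaps F (MatA N) 𝔸) (hloc : Localizes17OfRecord₁₃ F N θ S emb)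
    (sp : (K k : ℕ) → (domSys (F.P K) M (k + 1)).Dom → Set (CPair (F.P K) 𝔸))
    {κ κE δ₀ B₃ r ℓ₁ c ω₁ : ℝ} {lam : ℕ → ℕ → ℝ} {a : ℕ → ℕ → ℕ → ℝ}
    (hκ₀ : kappa₀ (4 * 2 ^ 4) (2 * 4) ≤ κ / 2) (hδ₀ : 0 < δ₀) (hB₃ : 0 ≤ B₃) (hr : 0 < r) (hκE : κ ≤ κE)
    (hT1 : ∀ K, ∀ g ∈ Window θ.γ, ∀ g' ∈ Window θ.γ, ∀ (D : ℕ → ℝ) (k : ℕ),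
      (∀ k' < k, ∀ (X' : (domSys (F.P K) M (k' + 1)).Dom), ∀ φ' ∈ sp K k' X',
        ‖termC (S K) (k' + 1) X' g φ' - termC (S K) (k' + 1) X' g' φ'‖ ≤ Real.exp (-(κE * (domSys (F.P K) M (k' + 1)).dj X')) * D (k' + 1)) →
      ∀ (X : (domSys (F.P K) M (k + 1)).Dom), ∀ φ ∈ sp K k X,
        ‖termC (S K) (k + 1) X g φ - termC (S K) (k + 1) X g' φ‖ ≤
          Real.exp (-(κE * (domSys (F.P K) M (k + 1)).dj X)) * (lam K k * |g k - g' k| + ∑ j ∈ range (k + 1), a K k j * D j))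
    (hlam : ∀ K k, lam K k ≤ ℓ₁) (hℓ₁ : 0 ≤ ℓ₁) (ha : ∀ K k j, j ≤ k → a K k j ≤ c * ω₁ ^ (k - j)) (hc : 0 ≤ c) (hω₁ : 0 ≤ ω₁)
    (Ec : ℕ → ℕ → Type*) [∀ K k, NormedAddCommGroup (Ec K k)] [∀ K k, NormedSpace ℂ (Ec K k)]
    (ι : letI := θ.instVβ₁; letI := θ.instVβ₂
      (K k : ℕ) → (domSys (F.P K) M (k + 1)).Dom → ((Fin (F.P K).d → Site (F.P K) (k + 1) → θ.Vβ) →L[ℝ] Ec K k))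
    (Φ : (K k : ℕ) → (domSys (F.P K) M (k + 1)).Dom → Ec K k → CPair (F.P K) 𝔸)
    (U : (K k : ℕ) → (domSys (F.P K) M (k + 1)).Dom → Set (Ec K k)) (hU : ∀ K k X, IsOpen (U K k X)) (hrU : ∀ K k X, ball (0 : Ec K k) r ⊆ U K k X)
    (hEhol : ∀ g ∈ Window θ.γ, ∀ (K k : ℕ) (X : (domSys (F.P K) M (k + 1)).Dom),
      DifferentiableOn ℂ (fun z => ((S K) k).E (histPrefix g k) (Φ K k X z) X) (U K k X))
    (hΦemb : letI := θ.instVβ₁; letI := θ.instVβ₂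
      ∀ (K k : ℕ) (X : (domSys (F.P K) M (k + 1)).Dom) (Bf : Fin (F.P K).d → Site (F.P K) (k + 1) → θ.Vβ),
        Φ K k X (ι K k X Bf) = emb K k (fun l t => NormedSpace.exp (θ.ρ8 (Bf l t))))
    (hΦsp : ∀ (K k : ℕ) (X : (domSys (F.P K) M (k + 1)).Dom), ∀ z ∈ ball (0 : Ec K k) r, Φ K k X z ∈ sp K k X)
    (w : (K k : ℕ) → (domSys (F.P K) M (k + 1)).Dom → Site (F.P K) (k + 1) → ℝ) (hw₀ : ∀ K k X t, 0 ≤ w K k X t)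
    (hw : letI := θ.instVβ₁; letI := θ.instVβ₂; letI := θ.instιβ
      ∀ (K k : ℕ) (X : (domSys (F.P K) M (k + 1)).Dom) (l : Fin (F.P K).d) (t : Site (F.P K) (k + 1)) (c : θ.ιβ),
        ‖ι K k X (Pi.single l (Pi.single t (θ.bV c)))‖ ≤ w K k X t)
    (htail : ∀ (K k : ℕ) (X : (domSys (F.P K) M (k + 1)).Dom) (t : Site (F.P K) (k + 1)),
      let e : Site (F.P K) (k + 1) → TPt 4 (domCount (F.P K) M (k + 1) * M) := fun x i => (ZMod.cast (x i) : ZMod (domCount (F.P K) M (k + 1) * M))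
      w K k X t ≤ B₃ * Real.exp (-δ₀ * distCT (domCount (F.P K) M (k + 1)) M (e t) (nearT (M := M) (e t) X)))
    (hμω : ω₁ + c ≤ ℓ.ω) (hℓκ : ℓ.κ ≤ delta1 δ₀ κ ((M : ℝ) * 4))
    (hrow : 16 * B₃ ^ 2 / r ^ 2 * Real.exp (delta1 δ₀ κ ((M : ℝ) * 4) * ((M : ℝ) * 4) * 3) * K₀ (4 * 2 ^ 4) (2 * 4) * K₁ 4 (δ₀ / 2) * ℓ₁ ≤ ℓ.C₉ * ℓ.ω) (k : ℕ) :
    N22At (u3OfRecord₁₃ θ (objectsOfRecord₁₃ F N θ ℓ) k) :=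
  (n22At_u3OfRecord₁₃_objectsOfRecord₁₃_iff F N θ ℓ hs k).2
    (ne9_EA_objectsOfRecord₁₃_of_termStepLipschitz F N θ ℓ hs hγ hlim m' M hM S emb hloc sp hκ₀ hδ₀ hB₃ hr hκE hT1 hlam hℓ₁ ha hc hω₁ Ec ι Φ U hU hrU hEhol hΦemb hΦsp
      w hw₀ hw htail hμω hℓκ hrow)

open Classical Finset in
/-- ★★★ **THE N22 PIN FACE ON ROAD 1**: under K3's node-U3 pin at the tuple (`hpin`), §2's inputs at `θ.toStage13Params` give `N22At (rateCarriersOfRecord₁₃CoPH 𝔯 F θ hP g₀ os k).u3` for EVERY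
run length `k` — dag-n22-w3's pin form.  THE N22 ROW SENTENCE on ROAD 1: «the first-order Lipschitz structure of the step map {last coupling, older TERMS} ↦ new TERM on every torus with
growth `ω₁ + c ≤ ω` + the readings, the law and (1.21) ⇒ §2b `h9` ∕ `N22At` — nothing from node N18».  LOCATED (hypothesis form); N22 NOT discharged. [folklore] -/
theorem n22At_rateCarriers_of_kernels_pin_of_termStepLipschitz (𝔯 : RateReading₁₃CoPH N) (θ : Stage13HParams F N) (hP : θ.Provisos₁₃CoPH F N)
    (g₀ : ℕ → ℝ) (os : List (ULoop F)) (ℓ : U3Letters₁₁) (hs : ℓ.Signs) (hγ : 0 < θ.γ)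
    (hpin : (𝔯.lit F θ hP g₀ os).u3 = objectsOfRecord₁₃ F N θ.toStage13Params ℓ) (hlim : PolLimitsExistOfRecord₁₃ F N θ.toStage13Params)
    (m' : ℕ) (M : ℕ) [NeZero M] (hM : M = F.L ^ m')
    (S : (K : ℕ) → ClusterTower (F.P K) 𝔸 M) (emb : ReadingMaps F (MatA N) 𝔸) (hloc : Localizes17OfRecord₁₃ F N θ.toStage13Params S emb)
    (sp : (K k : ℕ) → (domSys (F.P K) M (k + 1)).Dom → Set (CPair (F.P K) 𝔸))
    {κ κE δ₀ B₃ r ℓ₁ c ω₁ : ℝ} {lam : ℕ → ℕ → ℝ} {a : ℕ → ℕ → ℕ → ℝ}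
    (hκ₀ : kappa₀ (4 * 2 ^ 4) (2 * 4) ≤ κ / 2) (hδ₀ : 0 < δ₀) (hB₃ : 0 ≤ B₃) (hr : 0 < r) (hκE : κ ≤ κE)
    (hT1 : ∀ K, ∀ g ∈ Window θ.γ, ∀ g' ∈ Window θ.γ, ∀ (D : ℕ → ℝ) (k : ℕ),
      (∀ k' < k, ∀ (X' : (domSys (F.P K) M (k' + 1)).Dom), ∀ φ' ∈ sp K k' X',
        ‖termC (S K) (k' + 1) X' g φ' - termC (S K) (k' + 1) X' g' φ'‖ ≤ Real.exp (-(κE * (domSys (F.P K) M (k' + 1)).dj X')) * D (k' + 1)) →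
      ∀ (X : (domSys (F.P K) M (k + 1)).Dom), ∀ φ ∈ sp K k X,
        ‖termC (S K) (k + 1) X g φ - termC (S K) (k + 1) X g' φ‖ ≤
          Real.exp (-(κE * (domSys (F.P K) M (k + 1)).dj X)) * (lam K k * |g k - g' k| + ∑ j ∈ range (k + 1), a K k j * D j))
    (hlam : ∀ K k, lam K k ≤ ℓ₁) (hℓ₁ : 0 ≤ ℓ₁) (ha : ∀ K k j, j ≤ k → a K k j ≤ c * ω₁ ^ (k - j)) (hc : 0 ≤ c) (hω₁ : 0 ≤ ω₁)
    (Ec : ℕ → ℕ → Type*) [∀ K k, NormedAddCommGroup (Ec K k)] [∀ K k, NormedSpace ℂ (Ec K k)]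
    (ι : letI := θ.instVβ₁; letI := θ.instVβ₂
      (K k : ℕ) → (domSys (F.P K) M (k + 1)).Dom → ((Fin (F.P K).d → Site (F.P K) (k + 1) → θ.Vβ) →L[ℝ] Ec K k))
    (Φ : (K k : ℕ) → (domSys (F.P K) M (k + 1)).Dom → Ec K k → CPair (F.P K) 𝔸)
    (U : (K k : ℕ) → (domSys (F.P K) M (k + 1)).Dom → Set (Ec K k)) (hU : ∀ K k X, IsOpen (U K k X)) (hrU : ∀ K k X, ball (0 : Ec K k) r ⊆ U K k X)
    (hEhol : ∀ g ∈ Window θ.γ, ∀ (K k : ℕ) (X : (domSys (F.P K) M (k + 1)).Dom),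
      DifferentiableOn ℂ (fun z => ((S K) k).E (histPrefix g k) (Φ K k X z) X) (U K k X))
    (hΦemb : letI := θ.instVβ₁; letI := θ.instVβ₂
      ∀ (K k : ℕ) (X : (domSys (F.P K) M (k + 1)).Dom) (Bf : Fin (F.P K).d → Site (F.P K) (k + 1) → θ.Vβ),
        Φ K k X (ι K k X Bf) = emb K k (fun l t => NormedSpace.exp (θ.ρ8 (Bf l t))))
    (hΦsp : ∀ (K k : ℕ) (X : (domSys (F.P K) M (k + 1)).Dom), ∀ z ∈ ball (0 : Ec K k) r, Φ K k X z ∈ sp K k X)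
    (w : (K k : ℕ) → (domSys (F.P K) M (k + 1)).Dom → Site (F.P K) (k + 1) → ℝ) (hw₀ : ∀ K k X t, 0 ≤ w K k X t)
    (hw : letI := θ.instVβ₁; letI := θ.instVβ₂; letI := θ.instιβ
      ∀ (K k : ℕ) (X : (domSys (F.P K) M (k + 1)).Dom) (l : Fin (F.P K).d) (t : Site (F.P K) (k + 1)) (c : θ.ιβ),
        ‖ι K k X (Pi.single l (Pi.single t (θ.bV c)))‖ ≤ w K k X t)
    (htail : ∀ (K k : ℕ) (X : (domSys (F.P K) M (k + 1)).Dom) (t : Site (F.P K) (k + 1)),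
      let e : Site (F.P K) (k + 1) → TPt 4 (domCount (F.P K) M (k + 1) * M) := fun x i => (ZMod.cast (x i) : ZMod (domCount (F.P K) M (k + 1) * M))
      w K k X t ≤ B₃ * Real.exp (-δ₀ * distCT (domCount (F.P K) M (k + 1)) M (e t) (nearT (M := M) (e t) X)))
    (hμω : ω₁ + c ≤ ℓ.ω) (hℓκ : ℓ.κ ≤ delta1 δ₀ κ ((M : ℝ) * 4))
    (hrow : 16 * B₃ ^ 2 / r ^ 2 * Real.exp (delta1 δ₀ κ ((M : ℝ) * 4) * ((M : ℝ) * 4) * 3) * K₀ (4 * 2 ^ 4) (2 * 4) * K₁ 4 (δ₀ / 2) * ℓ₁ ≤ ℓ.C₉ * ℓ.ω) (k : ℕ) :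
    N22At (rateCarriersOfRecord₁₃CoPH 𝔯 F θ hP g₀ os k).u3 :=
  n22At_rateCarriers_of_kernels_pin_of_ne9 𝔯 θ hP g₀ os ℓ hs hpin
    (ne9_EA_objectsOfRecord₁₃_of_termStepLipschitz F N θ.toStage13Params ℓ hs hγ hlim m' M hM S emb hloc sp hκ₀ hδ₀ hB₃ hr hκE hT1 hlam hℓ₁ ha hc hω₁ Ec ι Φ U hU hrU
      hEhol hΦemb hΦsp w hw₀ hw htail hμω hℓκ hrow) k

end YMDAG.N22.KernelFading

end
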